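import Summits.BirchSwinnertonDyer.BirchSwinnertonDyer.Theorems.RamifiedSevenEllipticUnitsDeuringShapeOfPinned
import Summits.BirchSwinnertonDyer.BirchSwinnertonDyer.Theorems.RamifiedSevenEllipticUnitsGeneratorShapeOfPinned
import Summits.BirchSwinnertonDyer.BirchSwinnertonDyer.Theorems.RamifiedSevenEllipticUnitsQuadraticRamificationAtFrame
import HarnessLib

set_option linter.dupNamespace false
set_option autoImplicit false

/-!
# K7r crux `EllipticUnitValueSevenOfGZK` (stmt-BirchSwinnertonDyer-19945), line `rubin-formula-zp` —
# THE TWO DEURING NODES OF THE LINE FROM THE CORE «some `(1,0)` character is `L`-pinned»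
# (cell `bsd-cm`, seat `bsd-cm-k7r-c2` g17, FILE C2 = sequel of `…DeuringShapeOfPinned`; helper `--supports`
# 19945; THEOREMS ONLY, no named fact introduced)

HONEST FRAMING. The v4.6 candidate chain (`…RubinPackageOfDeuring`, p534778; `…RubinPackageOfTwist`, p528122;
`…QuadraticRamificationAwayOfTwist`, p524956; `…TwistTransportPinned`, p524150) consumes the named fact
`Deuring_exists_heckeCharacter_of_maximalCM` through exactly TWO nodes:
(N1) `TwistTransport.exists_pinned_cm7` — Deuring's `ψ₇` of `cm7 = 49a1` (type `(1,0)`, equivariant, pinned,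
unramified at every `w ∌ 7`), the only Deuring input of `eq_or_eq_galConj_twist_of_pinned` →
`sq_isUnramifiedAt_of_pinned_of_seven_notMem` → `RubinPackageOfTwist.interpolated_not_isUnramifiedAt` ((P3));
(N2) `RubinPackageOfDeuring.exists_deuringCharacter_of_cmFieldDiscr` — for the member `W` and the base model
`W₀`: type `(1,0)`, equivariant, pinned, cofinite generator shape (the input of (P1)/(P2)/(P5)).
THIS FILE proves that the OUTPUT of each node follows from the CORE «there is SOME Hecke character of
infinity type `(1,0)` with `heckeLFunction ψ s = V.LSeries s` on `re s > 3/2`» at `cm7`, resp. at the curve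
— by FILE C (`DeuringShape.isHeckeConjEquivariant_of_pinned`, `….isUnramifiedAt_of_pinned_of_hasGoodReduction`)
and FILE A (`GeneratorShape.shape_of_pinned`) — and records that the core is clauses (i) ∧ (v) of the display
(`core_of_deuring`, CONDITIONAL on the named fact). HONEST READING: of PLAIN Deuring only «`L(E/ℚ, s) =
L(s, ψ)` for SOME `(1,0)` character `ψ`» (Silverman II Thm. 10.5 (b) with the type of Thm. 9.2 (a)) is
load-bearing on the K7r line; Thm. 9.2 (b), the equivariance (Li–Xu/Jia) and the value laws (Ex. 2.30) are
theorems of the pinning. NOT done here (planner's call; mechanical): re-plumbing the assembly files, which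
take `hDe` BY NAME, onto the core. The display is ONE named fact and stays XL PRINT; a weaker display is the
typing layer's / planner's pen; no skeleton statement changes; 19945 OPEN; BSD not claimed.

References: [SilvermanATAEC1994] II Thm. 9.2, Prop. 10.4, Thm. 10.5 (b); [Cremona1997] Table 1 (49a1);
[NeukirchANT1999] VII (6.13), (8.1); cell texts STATUS 2026-08-27 D239/D247/D248, k7r-c2 g17 14:3xZ.
-/

noncomputable section

open scoped Classical ComplexConjugate
open Filter NumberField IsDedekindDomain WeierstrassCurve
  Literature.NumberTheory.GaloisRepresentations
  Literature.NumberTheory.LFunctions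
  Literature.NumberTheory.EllipticCurves
  Literature.NumberTheory.EllipticCurves.ModularForms
  Literature.NumberTheory.EllipticCurves.Rank1Residual
  Summit.BirchSwinnertonDyer.Rank1Residual Summit.BirchSwinnertonDyer.Rank1Residual.X12
  Summit.BirchSwinnertonDyer.Rank1Residual.X12.O11

namespace Summit.BirchSwinnertonDyer.BirchSwinnertonDyer.Theorems.RamifiedSevenEllipticUnits

namespace DeuringShape

variable {K : Type} [Field K] [NumberField K]

/-! ## §5 CONSUMPTION: the two Deuring nodes of the K7r line follow from «some `(1,0)` character is pinned» -/

section Consumption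

/-- **The `cm7` node from the CORE.** If SOME Hecke character of `K` (`d_K = −7`, `c ≠ 1`) of infinity type
`(1, 0)` is `L`-pinned to `cm7 = 49a1`, then there is one with ALL the properties
`TwistTransport.exists_pinned_cm7` extracts from PLAIN Deuring — type `(1,0)`, conj-equivariant (§3),
pinned, and unramified at every `w ∌ 7` (§4: `49a1` has good reduction at every `ℓ ≠ 7`, and `ℓ ≠ 7` is
unramified in `ℚ(√−7)`). So of `Deuring_exists_heckeCharacter_of_maximalCM` only clauses (i) and (v) AT
`cm7` are load-bearing for that node. [cite: SilvermanATAEC1994, Ch. II Thm. 10.5 (b) (L(E/ℚ,s) = L(s,ψ): the load-bearing clause)]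
[cite: Cremona1997, Table 1 (curve 49a1: Δ = −7³)] -/
theorem exists_pinned_cm7_of_core (hK : IsImaginaryQuadratic K) (hdK : NumberField.discr K = -7)
    (c : K ≃ₐ[ℚ] K) (hc : c ≠ 1)
    (hcore : ∃ ψ₇ : HeckeCharacter K, ψ₇.HasInfinityType (fun _ ↦ 1) (fun _ ↦ 0) ∧
      ∀ s : ℂ, 3 / 2 < s.re → heckeLFunction ψ₇ s = cm7.LSeries s) :
    ∃ ψ₇ : HeckeCharacter K, ψ₇.HasInfinityType (fun _ ↦ 1) (fun _ ↦ 0) ∧ IsHeckeConjEquivariant c ψ₇ ∧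
      (∀ s : ℂ, 3 / 2 < s.re → heckeLFunction ψ₇ s = cm7.LSeries s) ∧
      ∀ w : HeightOneSpectrum (𝓞 K), ((7 : ℕ) : 𝓞 K) ∉ w.asIdeal → ψ₇.IsUnramifiedAt w := by
  obtain ⟨ψ, hinf, hpin⟩ := hcore
  haveI := cm7_isGloballyMinimal
  refine ⟨ψ, hinf, isHeckeConjEquivariant_of_pinned hK c hc hinf cm7 (3 / 2) hpin, hpin, fun w hw ↦ ?_⟩
  set ℓ : ℕ := Rat.HeightOneSpectrum.natGenerator (w.under (𝓞 ℚ)) with hℓ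
  have hℓp : ℓ.Prime := Rat.HeightOneSpectrum.prime_natGenerator _
  haveI : Fact ℓ.Prime := ⟨hℓp⟩
  have hℓ7 : ℓ ≠ 7 := TwistTransport.natGenerator_under_ne_of_notMem w hw
  have hℓw : ((ℓ : ℕ) : 𝓞 K) ∈ w.asIdeal :=
    (asIdeal_under_eq_iff_natCast_mem (w.under (𝓞 ℚ)) w).mp (HeightOneSpectrum.under_asIdeal _ _).symm
  have hgood : cm7.HasGoodReductionAtPrime ℓ := cm7_hasGoodReductionAtPrime ℓ hℓ7
  have hnd : ¬ (ℓ : ℤ) ∣ NumberField.discr K := by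
    rw [hdK]
    intro h
    have h' : ℓ ∣ 7 := by
      have := Int.natCast_dvd.mp (Int.dvd_neg.mp h)
      simpa using this
    rcases (Nat.dvd_prime (by norm_num : (7 : ℕ).Prime)).mp h' with h1 | h7
    · exact hℓp.one_lt.ne' h1
    · exact hℓ7 h7
  exact isUnramifiedAt_of_pinned_of_hasGoodReduction hK.1 hpin hgood hnd w hℓw

/-- **FILE B §1's node from the CORE.** If SOME `(1, 0)` character of the imaginary quadratic PID field `K`
is `L`-pinned to a Weierstrass curve `V/ℚ`, then there is one with everything
`RubinPackageOfDeuring.exists_deuringCharacter_of_cmFieldDiscr` extracts from PLAIN Deuring: type `(1,0)`,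
conj-equivariant (§3), pinned, and the cofinite GENERATOR SHAPE (FILE A `GeneratorShape.shape_of_pinned`).
So of `Deuring_exists_heckeCharacter_of_maximalCM` only clauses (i) and (v) are load-bearing for that node
too; (ii) and (vi) are theorems. [cite: SilvermanATAEC1994, Ch. II Thm. 10.5 (b) and Prop. 10.4 (the statements; (ii), (vi) DERIVED)] -/
theorem exists_deuringCharacter_of_core (hK : IsImaginaryQuadratic K) [IsPrincipalIdealRing (𝓞 K)]
    (c : K ≃ₐ[ℚ] K) (hc : c ≠ 1) {V : WeierstrassCurve ℚ}
    (hcore : ∃ ψ : HeckeCharacter K, ψ.HasInfinityType (fun _ ↦ 1) (fun _ ↦ 0) ∧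
      ∀ s : ℂ, 3 / 2 < s.re → heckeLFunction ψ s = V.LSeries s) :
    ∃ ψ : HeckeCharacter K,
      ψ.HasInfinityType (fun _ ↦ 1) (fun _ ↦ 0) ∧ IsHeckeConjEquivariant c ψ ∧
      (∀ s : ℂ, 3 / 2 < s.re → heckeLFunction ψ s = V.LSeries s) ∧
      ∃ (σ : K →+* ℂ) (S : Set (HeightOneSpectrum (𝓞 K))), S.Finite ∧ ∀ w ∉ S,
        ψ.IsUnramifiedAt w ∧ ∃ α : 𝓞 K, Ideal.span {α} = w.asIdeal ∧ ψ.valueAtUniformizer w = σ (α : K) := by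
  obtain ⟨ψ, hinf, hpin⟩ := hcore
  obtain ⟨w₀⟩ : Nonempty (InfinitePlace K) := inferInstance
  obtain ⟨S, hS, hshape⟩ := GeneratorShape.shape_of_pinned hK w₀ hinf V (3 / 2) hpin
  exact ⟨ψ, hinf, isHeckeConjEquivariant_of_pinned hK c hc hinf V (3 / 2) hpin, hpin, w₀.embedding, S, hS,
    hshape⟩

/-- **Node (N1) from the CORE IN THE DISPLAY'S SHAPE.** If for every globally minimal maximal-order CM curve
`W/ℚ` with CM field `K` (`d_K = −7`) SOME `(1,0)` character of `K` is `L`-pinned to `W` (clauses (i) ∧ (v) of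
`Deuring_exists_heckeCharacter_of_maximalCM` for this `K`), then the output of `TwistTransport.exists_pinned_cm7`
holds: apply the hypothesis at `cm7` (`j = −3375 ∈ maximalCMJInvariants`, `IsCMFieldOfJ K cm7.j`) and §5's
`exists_pinned_cm7_of_core`. [cite: SilvermanATAEC1994, Ch. II Thm. 10.5 (b)] [cite: Cremona1997, Table 1 (49a1)] -/
theorem exists_pinned_cm7_of_coreDisplay (hK : IsImaginaryQuadratic K) (hdK : NumberField.discr K = -7)
    (c : K ≃ₐ[ℚ] K) (hc : c ≠ 1)
    (hcore : ∀ (W : WeierstrassCurve ℚ) [W.IsElliptic] [W.IsGloballyMinimal], W.j ∈ maximalCMJInvariants →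
      IsCMFieldOfJ K W.j → ∃ ψ : HeckeCharacter K, ψ.HasInfinityType (fun _ ↦ 1) (fun _ ↦ 0) ∧
        ∀ s : ℂ, 3 / 2 < s.re → heckeLFunction ψ s = W.LSeries s) :
    ∃ ψ₇ : HeckeCharacter K, ψ₇.HasInfinityType (fun _ ↦ 1) (fun _ ↦ 0) ∧ IsHeckeConjEquivariant c ψ₇ ∧
      (∀ s : ℂ, 3 / 2 < s.re → heckeLFunction ψ₇ s = cm7.LSeries s) ∧
      ∀ w : HeightOneSpectrum (𝓞 K), ((7 : ℕ) : 𝓞 K) ∉ w.asIdeal → ψ₇.IsUnramifiedAt w := by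
  haveI := cm7_isGloballyMinimal
  have hKj : IsCMFieldOfJ K cm7.j :=
    QuadraticRamification.isCMFieldOfJ_of_discr_eq TwistTransport.j_cm7_mem_maximalCMJInvariants
      TwistTransport.cmFieldDiscrOfJ_cm7 hK.1 hdK
  exact exists_pinned_cm7_of_core hK hdK c hc (hcore cm7 TwistTransport.j_cm7_mem_maximalCMJInvariants hKj)

/-- **Node (N2) from the CORE IN THE DISPLAY'S SHAPE** — FILE B §1
(`RubinPackageOfDeuring.exists_deuringCharacter_of_cmFieldDiscr`) with its Deuring input weakened to clauses
(i) ∧ (v): for `V/ℚ` with CM and `cmFieldDiscrOfJ V.j = −7`, `K` imaginary quadratic with `d_K = −7`, `c ≠ 1`,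
the hypothesis at the isogenous globally minimal maximal-order model `V₁` (same `L`-series,
`QuadraticRamification.exists_isogenous_maximal_model`) gives a `(1,0)` character pinned to `V`; `𝓞_K` is
principal (`isPrincipalIdealRing_of_isCMFieldOfJ`); conclude by `exists_deuringCharacter_of_core` (equivariance
FILE C §3, generator shape FILE A). [cite: SilvermanATAEC1994, Ch. II Thm. 10.5 (b) and Prop. 10.4 ((ii), (vi) DERIVED)] -/
theorem exists_deuringCharacter_of_cmFieldDiscr_of_coreDisplay
    (hcore : ∀ (W : WeierstrassCurve ℚ) [W.IsElliptic] [W.IsGloballyMinimal], W.j ∈ maximalCMJInvariants →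
      IsCMFieldOfJ K W.j → ∃ ψ : HeckeCharacter K, ψ.HasInfinityType (fun _ ↦ 1) (fun _ ↦ 0) ∧
        ∀ s : ℂ, 3 / 2 < s.re → heckeLFunction ψ s = W.LSeries s)
    {V : WeierstrassCurve ℚ} [V.IsElliptic] (hVcm : V.HasCM) (hVj : cmFieldDiscrOfJ V.j = -7)
    (hK : IsImaginaryQuadratic K) (hdK : NumberField.discr K = -7) (c : K ≃ₐ[ℚ] K) (hc : c ≠ 1) :
    ∃ ψ : HeckeCharacter K,
      ψ.HasInfinityType (fun _ ↦ 1) (fun _ ↦ 0) ∧ IsHeckeConjEquivariant c ψ ∧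
      (∀ s : ℂ, 3 / 2 < s.re → heckeLFunction ψ s = V.LSeries s) ∧
      ∃ (σ : K →+* ℂ) (S : Set (HeightOneSpectrum (𝓞 K))), S.Finite ∧ ∀ w ∉ S,
        ψ.IsUnramifiedAt w ∧ ∃ α : 𝓞 K, Ideal.span {α} = w.asIdeal ∧ ψ.valueAtUniformizer w = σ (α : K) := by
  obtain ⟨V₁, _, _, -, hj₁, hd₁, hLV⟩ := QuadraticRamification.exists_isogenous_maximal_model hVcm
  rw [hVj] at hd₁
  have hKj : IsCMFieldOfJ K V₁.j := QuadraticRamification.isCMFieldOfJ_of_discr_eq hj₁ hd₁ hK.1 hdK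
  haveI : IsPrincipalIdealRing (𝓞 K) := isPrincipalIdealRing_of_isCMFieldOfJ K hj₁ hKj
  obtain ⟨ψ, hinf, hL⟩ := hcore V₁ hj₁ hKj
  have hpin : ∀ s : ℂ, 3 / 2 < s.re → heckeLFunction ψ s = V.LSeries s := fun s hs ↦ by
    rw [hLV]; exact hL s hs
  exact exists_deuringCharacter_of_core hK c hc ⟨ψ, hinf, hpin⟩

/-- **The CORE IN THE DISPLAY'S SHAPE follows from the display** (CONDITIONAL on the named fact; `K`
imaginary quadratic supplies the `c ≠ 1` the fact's binder wants, `Rigidity.card_algEquiv_eq_two`).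
[cite: SilvermanATAEC1994, Ch. II Thm. 9.2 and Thm. 10.5 (b)] -/
theorem coreDisplay_of_deuring (hDe : Deuring_exists_heckeCharacter_of_maximalCM) (h2 : Module.finrank ℚ K = 2) :
    ∀ (W : WeierstrassCurve ℚ) [W.IsElliptic] [W.IsGloballyMinimal], W.j ∈ maximalCMJInvariants →
      IsCMFieldOfJ K W.j → ∃ ψ : HeckeCharacter K, ψ.HasInfinityType (fun _ ↦ 1) (fun _ ↦ 0) ∧
        ∀ s : ℂ, 3 / 2 < s.re → heckeLFunction ψ s = W.LSeries s := by
  intro W _ _ hj hKj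
  obtain ⟨c, hc⟩ : ∃ c : K ≃ₐ[ℚ] K, c ≠ 1 := by
    by_contra! h
    have hcard := Rigidity.card_algEquiv_eq_two (K := K) h2
    haveI : Unique (K ≃ₐ[ℚ] K) := ⟨⟨1⟩, fun a ↦ h a⟩
    rw [Nat.card_unique] at hcard
    norm_num at hcard
  obtain ⟨ψ, hinf, -, -, -, hL⟩ := hDe W hj K hKj c hc
  exact ⟨ψ, hinf, hL⟩

/-- **The CORE is a clause of the display** (bookkeeping, CONDITIONAL on the named fact): PLAIN Deuring
gives, at every globally minimal maximal-order CM curve `W/ℚ` with CM field `K` and `c ≠ 1`, SOME `(1,0)`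
character `L`-pinned to `W` — clauses (i) and (v), the only ones §5 consumes.
[cite: SilvermanATAEC1994, Ch. II Thm. 9.2 and Thm. 10.5 (b)] -/
theorem core_of_deuring (hDe : Deuring_exists_heckeCharacter_of_maximalCM)
    (W : WeierstrassCurve ℚ) [W.IsElliptic] [W.IsGloballyMinimal] (hj : W.j ∈ maximalCMJInvariants)
    (hKj : IsCMFieldOfJ K W.j) (c : K ≃ₐ[ℚ] K) (hc : c ≠ 1) :
    ∃ ψ : HeckeCharacter K, ψ.HasInfinityType (fun _ ↦ 1) (fun _ ↦ 0) ∧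
      ∀ s : ℂ, 3 / 2 < s.re → heckeLFunction ψ s = W.LSeries s := by
  obtain ⟨ψ, hinf, -, -, -, hL⟩ := hDe W hj K hKj c hc
  exact ⟨ψ, hinf, hL⟩

end Consumption

end DeuringShape

end Summit.BirchSwinnertonDyer.BirchSwinnertonDyer.Theorems.RamifiedSevenEllipticUnits

end
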